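import Summits.Parity.GeneralizedHardyLittlewood.Theorems.PrimeLevelFamEdgeMomentsBeyondDiagonalFarLayersWeil
import Summits.Parity.GeneralizedHardyLittlewood.Theorems.PrimeLevelFamEdgeMomentsBeyondDiagonalCoreIsCrux
import HarnessLib

/-!
# Route `PrimeLevelFamEdge`, crux K_A `MomentsBeyondDiagonal` (stmt-Parity-20007), line «petersson_layers» v4:
# AFTER THE SATELLITES — among {K_A, `SubDiag`, `SubHeart ρ_W`} ANY TWO GIVE THE THIRD (no other stub involved)

With `SubFirst` (`stub_first`, p803664), the identification (`stub_identP`, p795653) and the Weil-cut far layers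
(`FarLayers.subFar_rhoWeil`, p810002) all PROVED, the difference-defined tail at the Weil cut has the printed shape
unconditionally (`FarLayers.subTail_rhoWeil`). Reading the layer split `Q^h = D − HEART(ρ_W) + TAIL(ρ_W)` forwards and backwards
(deck glue `MomentsBeyondDiagonal_of_layerSplit`, lead-g0 glue `subHeart_of_KA_diag_tail` / `subDiag_of_KA_heart_tail`, p625494):
* `subHeart_rhoWeil_of_KA_diag : KA → SubDiag → SubHeart ρ_W`, `subDiag_of_KA_heartWeil : KA → SubHeart ρ_W → SubDiag`;
* `KA_iff_subHeart_rhoWeil : SubDiag → (KA ↔ SubHeart ρ_W)` — **given the diagonal evaluation (stub_diag, a Mellin exercise), the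
  crux K_A IS EXACTLY the statement that the first `q̂^{4Δ'−3/2}` explicit Petersson layers `HEART(ρ_W) = Σ_{r ≤ q̂^{4Δ'−3/2}} K_r`
  have a level-free main term** (BN-7a's wall, now with both its flanks — below the diagonal cut and above the Weil cut — removed);
* `subDiag_iff_subHeart_rhoWeil : KA → (SubDiag ↔ SubHeart ρ_W)`.
HONESTY: equivalences only; neither K_A nor `SubDiag` nor `SubHeart ρ_W` is proved; nothing about Landau–Siegel zeros.
-/

noncomputable section

namespace Summit.Parity.GeneralizedHardyLittlewood.Theorems.MomentsBeyondDiagonal.FarLayers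

open Summit.Parity.GeneralizedHardyLittlewood.Theorems.PrimeLevelFamEdgeIdeaDeltas.PeterssonLayers


/-- Given K_A and the diagonal piece, the heart at the Weil cut has the printed shape (`heart = tail − (Q^h − D)`, with
`subTail_rhoWeil`). -/
theorem subHeart_rhoWeil_of_KA_diag (h : KA) (hD : SubDiag) : SubHeart rhoWeil :=
  subHeart_of_KA_diag_tail rhoWeil h hD subTail_rhoWeil

/-- Given K_A and the heart at the Weil cut, the diagonal piece has the printed shape (`D = (Q^h + heart) − tail`, with
`subTail_rhoWeil`). -/
theorem subDiag_of_KA_heartWeil (h : KA) (hH : SubHeart rhoWeil) : SubDiag :=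
  subDiag_of_KA_heart_tail rhoWeil h hH subTail_rhoWeil

/-- **THE CRUX IS THE HEART AT THE WEIL CUT (given the diagonal evaluation): `SubDiag → (K_A ↔ SubHeart ρ_W)`.** -/
theorem KA_iff_subHeart_rhoWeil (hD : SubDiag) : KA ↔ SubHeart rhoWeil :=
  ⟨fun h ↦ subHeart_rhoWeil_of_KA_diag h hD, fun hH ↦ momentsBeyondDiagonal_of_diag_heartWeil hD hH⟩

/-- Given K_A, the diagonal piece and the heart at the Weil cut are equivalent. -/
theorem subDiag_iff_subHeart_rhoWeil (h : KA) : SubDiag ↔ SubHeart rhoWeil :=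
  ⟨fun hD ↦ subHeart_rhoWeil_of_KA_diag h hD, fun hH ↦ subDiag_of_KA_heartWeil h hH⟩

/-- Given the heart at the Weil cut, K_A and the diagonal piece are equivalent. -/
theorem KA_iff_subDiag (hH : SubHeart rhoWeil) : KA ↔ SubDiag :=
  ⟨fun h ↦ subDiag_of_KA_heartWeil h hH, fun hD ↦ momentsBeyondDiagonal_of_diag_heartWeil hD hH⟩

end Summit.Parity.GeneralizedHardyLittlewood.Theorems.MomentsBeyondDiagonal.FarLayers

end
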